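import Summits.ResolutionOfSingularities.ResolutionOfSingularities.Theorems.FrobeniusLadderFInjectiveMacaulayficationPointFloorLegalCI
import Summits.ResolutionOfSingularities.ResolutionOfSingularities.Theorems.FrobeniusLadderFInjectiveMacaulayficationDiagonalBPCIChartsCM
import Summits.ResolutionOfSingularities.ResolutionOfSingularities.Theorems.FrobeniusLadderFInjectiveMacaulayficationDiagonalBPCIRow
import Summits.ResolutionOfSingularities.ResolutionOfSingularities.Theorems.FrobeniusLadderFInjectiveMacaulayficationFTemkinClosedPoints
import Summits.ResolutionOfSingularities.ResolutionOfSingularities.Theorems.FrobeniusLadderFInjectiveMacaulayficationFermatCubicConeGerm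
import HarnessLib

/-!
# BED CI-1 — THE FLOOR LEGAL COLUMN: for EVERY blowing up of `Spec 𝒪_{X,v}` along the point floor, `X = V(x₀²+x₁³+x₂³+x₃⁴+x₄⁵+x₅⁵, x₀²+2x₁³+3x₂³+4x₃⁴+5x₄⁵+6x₅⁵) ⊂ 𝔸⁶`
# (`char k = p ≥ 7`, `k` ANY field): the centre is non-zero and Sing-supported, `S′` is regular off the closed fibre and COHEN–MACAULAY AT EVERY STALK
# (crux `FInjectiveMacaulayfication` stmt-ResolutionOfSingularities-15315, chain w45a; res-L1-w45a-plan-1 RULING R23.11 (2) «FLOOR columns = CI twins of `PointFloorLegalOfIsolated` / …»;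
# seat res-L1-w45a-stub-2 g13)

[OURS · L1 W4.5a] Support file (`--supports stmt-ResolutionOfSingularities-15315 --as helper`); def-free; UNCONDITIONAL; no named fact, no sorry; NOT a statement of any
manuscript; replaces the role of NO printed item. Nothing of the crux is proved. AI-written (AI review weaker than expert review).

* §1 ★ `reesT_mem_radical` — THE CHARTS `D₊(x̄₂t), …, D₊(x̄₅t)` COVER `Bl_𝔪 X`: in the Rees algebra `R[𝔪t]`, `(x̄₀t)² = x̄₂(x̄₂t)² + 2x̄₃²(x̄₃t)² + 3x̄₄³(x̄₄t)² + 4x̄₅³(x̄₅t)²` (from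
  `x̄₀² = G(x̄)`) and `(x̄₁t)³ = −(2(x̄₂t)³ + 3x̄₃(x̄₃t)³ + 4x̄₄²(x̄₄t)³ + 5x̄₅²(x̄₅t)³)` (from `x̄₁³ = −H(x̄)`), so every `x̄ᵢt` lies in `√(x̄₂t, …, x̄₅t)`.
* §2 `vertex_not_mem_regularLocus` (the vertex is NOT regular: it is not even FULL, ✓ `DiagonalBPCIVertexNotFull`, while regular local rings are FULL), `regular_of_specializes`
  (every proper generization of the vertex is regular, ✓ `DiagonalCIPair.isRegularLocalRing_off_vertex_pair`, `p ≥ 7`).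
* §3 ★★★ `diagonalBPCI_pointFloor_input_legal` (`p ≥ 7`) — for every blowing up `g : S′ → Spec 𝒪_{X,v}` along `𝔪̃|`: (i) centre `≠ ⊥`; (ii) support `⊆ (Reg)ᶜ`; (iii) `S′` regular
  off the closed fibre; (iv) `S′` CM at every stalk — ONE application of ✓ `PointFloorLegalCI.pointFloor_input_legal` with the CM charts ✓ `DiagonalBPCIChartsCM`.
[folklore assembly; cite: GortzWedhorn2020, Prop. 13.91 (2); StacksProject, Tag 0804; Temkin2008, §2.1; Matsumura1987, Thm. 17.4]
-/

-- single-problem summit: the doubled namespace component is forced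
set_option linter.dupNamespace false

noncomputable section

namespace Summit.ResolutionOfSingularities.ResolutionOfSingularities.Theorems.FInjectiveMacaulayfication.DiagonalBPCIPointFloorLegal

open CategoryTheory AlgebraicGeometry TopologicalSpace IsLocalRing MvPolynomial
open Literature.AlgebraicGeometry.Resolution
open Summit.ResolutionOfSingularities.ResolutionOfSingularities.Theorems.FInjectiveMacaulayfication
open SliceableCentre GermOfGlobalBlowup

section Bed

variable (k : Type) [Field k] (F : Fin 2 → MvPolynomial (Fin 6) k)
  (hF0 : F 0 = X 0 ^ 2 + X 1 ^ 3 + X 2 ^ 3 + X 3 ^ 4 + X 4 ^ 5 + X 5 ^ 5)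
  (hF1 : F 1 = X 0 ^ 2 + C 2 * X 1 ^ 3 + C 3 * X 2 ^ 3 + C 4 * X 3 ^ 4 + C 5 * X 4 ^ 5 + C 6 * X 5 ^ 5)
include hF0 hF1

/-! ## §1 ★ The charts `x₂, …, x₅` cover the blow-up -/

/-- The two relations at the vertex: `x̄₀² = x̄₂³ + 2x̄₃⁴ + 3x̄₄⁵ + 4x̄₅⁵` and `x̄₁³ = −(2x̄₂³ + 3x̄₃⁴ + 4x̄₄⁵ + 5x̄₅⁵)` in `R = k[x]/(F₁, F₂)`. [plumbing] -/
theorem vertex_relations :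
    (Ideal.Quotient.mk (Ideal.span (Set.range F)) (X 0)) ^ 2 =
        Ideal.Quotient.mk (Ideal.span (Set.range F)) (X 2) ^ 3 + 2 * Ideal.Quotient.mk (Ideal.span (Set.range F)) (X 3) ^ 4 +
          3 * Ideal.Quotient.mk (Ideal.span (Set.range F)) (X 4) ^ 5 + 4 * Ideal.Quotient.mk (Ideal.span (Set.range F)) (X 5) ^ 5 ∧
      (Ideal.Quotient.mk (Ideal.span (Set.range F)) (X 1)) ^ 3 =
        -(2 * Ideal.Quotient.mk (Ideal.span (Set.range F)) (X 2) ^ 3 + 3 * Ideal.Quotient.mk (Ideal.span (Set.range F)) (X 3) ^ 4 +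
          4 * Ideal.Quotient.mk (Ideal.span (Set.range F)) (X 4) ^ 5 + 5 * Ideal.Quotient.mk (Ideal.span (Set.range F)) (X 5) ^ 5) := by
  have hP := Ideal.Quotient.eq_zero_iff_mem.mpr (DiagonalBPCIChart5NotFull.PQ_mem k F 0)
  have hQ := Ideal.Quotient.eq_zero_iff_mem.mpr (DiagonalBPCIChart5NotFull.PQ_mem k F 1)
  simp only [Matrix.cons_val_zero, Matrix.cons_val_one, hF0, hF1, map_sub, map_add, map_mul, map_pow, map_ofNat] at hP hQ
  exact ⟨by linear_combination hP, by linear_combination hQ⟩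

/-- ★ **THE CHARTS `D₊(x̄₂t), …, D₊(x̄₅t)` COVER `Bl_𝔪 X`**: every `x̄ᵢt` lies in the radical of `(x̄₂t, x̄₃t, x̄₄t, x̄₅t)` in the Rees algebra `R[𝔪t]` (`(x̄₀t)²` and `(x̄₁t)³` are
combinations of the `(x̄ⱼt)²`, `(x̄ⱼt)³`, `j ≥ 2`, by the vertex relations). [OURS · certificate; folklore] -/
theorem reesT_mem_radical : ∀ i : Fin 6, Ideal.Quotient.mk (Ideal.span (Set.range F)) (X i) ≠ 0 →
    reesT ((fun j : Fin 6 => Ideal.Quotient.mk (Ideal.span (Set.range F)) (X j)) i) (Ideal.subset_span (Set.mem_range_self i)) ∈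
      (Ideal.span {z : reesAlgebra (Ideal.span (Set.range (fun j : Fin 6 => Ideal.Quotient.mk (Ideal.span (Set.range F)) (X j)))) |
        ∃ j : Fin 6, (j = 2 ∨ j = 3 ∨ j = 4 ∨ j = 5) ∧
          z = reesT ((fun j : Fin 6 => Ideal.Quotient.mk (Ideal.span (Set.range F)) (X j)) j) (Ideal.subset_span (Set.mem_range_self j))}).radical := by
  set R := MvPolynomial (Fin 6) k ⧸ Ideal.span (Set.range F) with hR
  set x : Fin 6 → R := fun j => Ideal.Quotient.mk (Ideal.span (Set.range F)) (X j) with hx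
  set T : Fin 6 → reesAlgebra (Ideal.span (Set.range x)) := fun i => reesT (x i) (Ideal.subset_span (Set.mem_range_self i)) with hT
  have hgen : ∀ j : Fin 6, (j = 2 ∨ j = 3 ∨ j = 4 ∨ j = 5) →
      T j ∈ Ideal.span {z : reesAlgebra (Ideal.span (Set.range x)) | ∃ j : Fin 6, (j = 2 ∨ j = 3 ∨ j = 4 ∨ j = 5) ∧ z = T j} :=
    fun j hj => Ideal.subset_span ⟨j, hj, rfl⟩
  obtain ⟨hR0, hR1⟩ := vertex_relations k F hF0 hF1
  -- the two Rees-algebra identities, checked in `R[t]`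
  have hC0 : (Polynomial.C (x 0)) ^ 2 = Polynomial.C (x 2) ^ 3 + Polynomial.C 2 * Polynomial.C (x 3) ^ 4 + Polynomial.C 3 * Polynomial.C (x 4) ^ 5 +
      Polynomial.C 4 * Polynomial.C (x 5) ^ 5 := by
    have h := congrArg (Polynomial.C : R →+* Polynomial R) hR0
    simpa only [map_add, map_mul, map_pow] using h
  have hC1 : (Polynomial.C (x 1)) ^ 3 = -(Polynomial.C 2 * Polynomial.C (x 2) ^ 3 + Polynomial.C 3 * Polynomial.C (x 3) ^ 4 + Polynomial.C 4 * Polynomial.C (x 4) ^ 5 +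
      Polynomial.C 5 * Polynomial.C (x 5) ^ 5) := by
    have h := congrArg (Polynomial.C : R →+* Polynomial R) hR1
    simpa only [map_add, map_mul, map_pow, map_neg] using h
  have e0 : T 0 ^ 2 = algebraMap R _ (x 2) * T 2 * T 2 + algebraMap R _ (2 * x 3 ^ 2) * T 3 * T 3 + algebraMap R _ (3 * x 4 ^ 3) * T 4 * T 4 +
      algebraMap R _ (4 * x 5 ^ 3) * T 5 * T 5 := by
    apply Subtype.ext
    simp only [hT, Subalgebra.coe_pow, Subalgebra.coe_mul, Subalgebra.coe_add, Subalgebra.coe_algebraMap, coe_reesT, Polynomial.algebraMap_eq,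
      ← Polynomial.C_mul_X_eq_monomial, map_mul, map_pow]
    linear_combination (Polynomial.X : Polynomial R) ^ 2 * hC0
  have e1 : T 1 ^ 3 = -(algebraMap R _ 2 * T 2 * T 2 * T 2 + algebraMap R _ (3 * x 3) * T 3 * T 3 * T 3 + algebraMap R _ (4 * x 4 ^ 2) * T 4 * T 4 * T 4 +
      algebraMap R _ (5 * x 5 ^ 2) * T 5 * T 5 * T 5) := by
    apply Subtype.ext
    simp only [hT, Subalgebra.coe_pow, Subalgebra.coe_mul, Subalgebra.coe_add, Subalgebra.coe_neg, Subalgebra.coe_algebraMap, coe_reesT, Polynomial.algebraMap_eq,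
      ← Polynomial.C_mul_X_eq_monomial, map_mul, map_pow]
    linear_combination (Polynomial.X : Polynomial R) ^ 3 * hC1
  intro i _
  change T i ∈ _
  fin_cases i
  · refine ⟨2, ?_⟩
    show T 0 ^ 2 ∈ _
    rw [e0]
    refine add_mem (add_mem (add_mem ?_ ?_) ?_) ?_
    · exact Ideal.mul_mem_left _ _ (hgen 2 (Or.inl rfl))
    · exact Ideal.mul_mem_left _ _ (hgen 3 (Or.inr (Or.inl rfl)))
    · exact Ideal.mul_mem_left _ _ (hgen 4 (Or.inr (Or.inr (Or.inl rfl))))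
    · exact Ideal.mul_mem_left _ _ (hgen 5 (Or.inr (Or.inr (Or.inr rfl))))
  · refine ⟨3, ?_⟩
    show T 1 ^ 3 ∈ _
    rw [e1]
    refine neg_mem (add_mem (add_mem (add_mem ?_ ?_) ?_) ?_)
    · exact Ideal.mul_mem_left _ _ (hgen 2 (Or.inl rfl))
    · exact Ideal.mul_mem_left _ _ (hgen 3 (Or.inr (Or.inl rfl)))
    · exact Ideal.mul_mem_left _ _ (hgen 4 (Or.inr (Or.inr (Or.inl rfl))))
    · exact Ideal.mul_mem_left _ _ (hgen 5 (Or.inr (Or.inr (Or.inr rfl))))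
  · exact Ideal.le_radical (hgen 2 (Or.inl rfl))
  · exact Ideal.le_radical (hgen 3 (Or.inr (Or.inl rfl)))
  · exact Ideal.le_radical (hgen 4 (Or.inr (Or.inr (Or.inl rfl))))
  · exact Ideal.le_radical (hgen 5 (Or.inr (Or.inr (Or.inr rfl))))

/-! ## §2 The vertex is singular; its proper generizations are regular -/

/-- **The vertex is NOT a regular point**: a regular local ring of characteristic `p` is FULL (✓ `FTemkinClosedPoints.fullCl_of_isRegularLocalRing`), but `𝒪_{X,v}` is not
(✓ `DiagonalBPCIVertexNotFull.diagonalBPCI_vertex_not_full`). [OURS · certificate] -/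
theorem vertex_not_mem_regularLocus (p : ℕ) [Fact p.Prime] [CharP k p]
    (v : Spec (.of (MvPolynomial (Fin 6) k ⧸ Ideal.span (Set.range F))))
    (hvm : v.asIdeal = Ideal.span (Set.range fun j : Fin 6 => Ideal.Quotient.mk (Ideal.span (Set.range F)) (X j))) :
    v ∉ Scheme.regularLocus (Spec (.of (MvPolynomial (Fin 6) k ⧸ Ideal.span (Set.range F)))) := by
  intro hreg
  haveI : IsRegularLocalRing ((Spec (.of (MvPolynomial (Fin 6) k ⧸ Ideal.span (Set.range F)))).presheaf.stalk v) := hreg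
  haveI : CharP ((Spec (.of (MvPolynomial (Fin 6) k ⧸ Ideal.span (Set.range F)))).presheaf.stalk v) p :=
    FTemkinClosedPoints.charP_stalk_of_over p (Spec.map (CommRingCat.ofHom (algebraMap k (MvPolynomial (Fin 6) k ⧸ Ideal.span (Set.range F)))))
      (𝟙 (Spec (.of (MvPolynomial (Fin 6) k ⧸ Ideal.span (Set.range F))))) v
  exact DiagonalBPCIVertexNotFull.diagonalBPCI_vertex_not_full p k F hF0 hF1 v hvm (FTemkinClosedPoints.fullCl_of_isRegularLocalRing p _)

/-- **Every proper generization of the vertex is a regular point** (`p ≥ 7`: ✓ `DiagonalCIPair.isRegularLocalRing_off_vertex_pair`, exponents `2,3,3,4,5,5` and minors `j − i` non-zero).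
[OURS · certificate; cite: Matsumura1987, Thm. 14.2] -/
theorem regular_of_specializes (p : ℕ) [Fact p.Prime] (hp : 7 ≤ p) [CharP k p]
    (v : Spec (.of (MvPolynomial (Fin 6) k ⧸ Ideal.span (Set.range F))))
    (hvm : v.asIdeal = Ideal.span (Set.range fun j : Fin 6 => Ideal.Quotient.mk (Ideal.span (Set.range F)) (X j))) :
    ∀ y : Spec (.of (MvPolynomial (Fin 6) k ⧸ Ideal.span (Set.range F))), y ⤳ v → y ≠ v →
      y ∈ Scheme.regularLocus (Spec (.of (MvPolynomial (Fin 6) k ⧸ Ideal.span (Set.range F)))) := by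
  classical
  -- casts below `p`
  have hk : ∀ m : ℕ, 0 < m → m ≤ 6 → (m : k) ≠ 0 := fun m hm hm6 => DiagonalBPCIRow.natCast_ne_zero_of_lt p m hm (by omega)
  set a : Fin 6 → ℕ := ![2, 3, 3, 4, 5, 5] with ha_def
  have ha : ∀ i, a i ≠ 0 := fun i => by have := (DiagonalBPCIRow.two_le_a_le i).1; rw [← ha_def] at this; omega
  have hak : ∀ i, ((a i : ℕ) : k) ≠ 0 := fun i => hk (a i) (Nat.pos_of_ne_zero (ha i)) (by have := (DiagonalBPCIRow.two_le_a_le i).2; rw [← ha_def] at this; omega)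
  have hF0' : F 0 = ∑ i : Fin 6, monomial (Finsupp.single i (a i)) ((fun _ : Fin 6 => (1 : k)) i) := by rw [hF0, DiagonalBPCIRow.F0_eq_sum]
  have hF1' : F 1 = ∑ i : Fin 6, monomial (Finsupp.single i (a i)) ((fun i : Fin 6 => (((i : ℕ) + 1 : ℕ) : k)) i) := by rw [hF1, DiagonalBPCIRow.F1_eq_sum]
  have hc : ∀ i : Fin 6, (fun _ : Fin 6 => (1 : k)) i ≠ 0 := fun _ => one_ne_zero
  have hminor : ∀ i j : Fin 6, i ≠ j → (fun _ : Fin 6 => (1 : k)) i * (fun i : Fin 6 => (((i : ℕ) + 1 : ℕ) : k)) j ≠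
      (fun _ : Fin 6 => (1 : k)) j * (fun i : Fin 6 => (((i : ℕ) + 1 : ℕ) : k)) i := by
    intro i j hij h
    simp only [one_mul] at h
    have := CharP.natCast_injOn_Iio k p (by have := j.2; simp only [Set.mem_Iio]; omega) (by have := i.2; simp only [Set.mem_Iio]; omega) h
    exact hij (Fin.ext (by omega))
  intro y hyv hne
  refine FermatCubicConeGerm.mem_regularLocus_Spec_of_isRegularLocalRing _
    (DiagonalCIPair.isRegularLocalRing_off_vertex_pair p a ha hak _ _ hc hminor F hF0' hF1' y.asIdeal fun hle => hne ?_)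
  have h2 : y.asIdeal ≤ v.asIdeal := (PrimeSpectrum.le_iff_specializes y v).mpr hyv
  exact PrimeSpectrum.ext (le_antisymm h2 (hvm ▸ hle))

end Bed

/-! ## §3 ★★★ The floor LEGAL column of ROW #11 -/

/-- ★★★ **BED CI-1, FLOOR LEGAL COLUMN** (`char k = p ≥ 7`, `k` ANY field): for EVERY blowing up `g : S′ → Spec 𝒪_{X,v}` along the point floor `𝔪̃|`: (i) the centre is `≠ ⊥`;
(ii) its support lies in `(Reg Spec 𝒪_{X,v})ᶜ`; (iii) `S′` is regular off the closed fibre; (iv) `S′` is COHEN–MACAULAY AT EVERY STALK — the CM input being the four monic-tower Rees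
charts `D₊(x̄₂t), …, D₊(x̄₅t)` (✓ `DiagonalBPCIChartsCM`), which cover `Bl_𝔪 X` (`reesT_mem_radical`). ONE application of ✓ `PointFloorLegalCI.pointFloor_input_legal`.
[OURS · census certificate (floor LEGAL side of ROW #11); cite: GortzWedhorn2020, Prop. 13.91 (2); StacksProject, Tag 02OS and Tag 0804; Temkin2008, §2.1] -/
theorem diagonalBPCI_pointFloor_input_legal (p : ℕ) [Fact p.Prime] (hp : 7 ≤ p) (k : Type) [Field k] [CharP k p]
    (F : Fin 2 → MvPolynomial (Fin 6) k)
    (hF0 : F 0 = X 0 ^ 2 + X 1 ^ 3 + X 2 ^ 3 + X 3 ^ 4 + X 4 ^ 5 + X 5 ^ 5)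
    (hF1 : F 1 = X 0 ^ 2 + C 2 * X 1 ^ 3 + C 3 * X 2 ^ 3 + C 4 * X 3 ^ 4 + C 5 * X 4 ^ 5 + C 6 * X 5 ^ 5)
    (v : Spec (.of (MvPolynomial (Fin 6) k ⧸ Ideal.span (Set.range F))))
    (hvm : v.asIdeal = Ideal.span (Set.range fun j : Fin 6 => Ideal.Quotient.mk (Ideal.span (Set.range F)) (X j)))
    (S' : Scheme.{0}) (g' : S' ⟶ Spec ((Spec (.of (MvPolynomial (Fin 6) k ⧸ Ideal.span (Set.range F)))).presheaf.stalk v))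
    (hg' : IsBlowup g' ((affineBlowup.idealSheaf (Ideal.span (Set.range fun j : Fin 6 => Ideal.Quotient.mk (Ideal.span (Set.range F)) (X j)))).comap
      ((Spec (.of (MvPolynomial (Fin 6) k ⧸ Ideal.span (Set.range F)))).fromSpecStalk v))) :
    ((affineBlowup.idealSheaf (Ideal.span (Set.range fun j : Fin 6 => Ideal.Quotient.mk (Ideal.span (Set.range F)) (X j)))).comap
        ((Spec (.of (MvPolynomial (Fin 6) k ⧸ Ideal.span (Set.range F)))).fromSpecStalk v)) ≠ ⊥ ∧
      (((((affineBlowup.idealSheaf (Ideal.span (Set.range fun j : Fin 6 => Ideal.Quotient.mk (Ideal.span (Set.range F)) (X j)))).comap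
        ((Spec (.of (MvPolynomial (Fin 6) k ⧸ Ideal.span (Set.range F)))).fromSpecStalk v))).support :
          Set (Spec ((Spec (.of (MvPolynomial (Fin 6) k ⧸ Ideal.span (Set.range F)))).presheaf.stalk v))) ⊆
        (Scheme.regularLocus (Spec ((Spec (.of (MvPolynomial (Fin 6) k ⧸ Ideal.span (Set.range F)))).presheaf.stalk v)))ᶜ) ∧
      (∀ s : S', g'.base s ≠ closedPoint ((Spec (.of (MvPolynomial (Fin 6) k ⧸ Ideal.span (Set.range F)))).presheaf.stalk v) → s ∈ Scheme.regularLocus S') ∧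
      (∀ s : S', CMCl (S'.presheaf.stalk s)) := by
  have hk : ∀ m : ℕ, 0 < m → m ≤ 6 → (m : k) ≠ 0 := fun m hm hm6 => DiagonalBPCIRow.natCast_ne_zero_of_lt p m hm (by omega)
  have h3 : (3 : k) ≠ 0 := by exact_mod_cast hk 3 (by norm_num) (by norm_num)
  have h4 : (4 : k) ≠ 0 := by exact_mod_cast hk 4 (by norm_num) (by norm_num)
  haveI hI : (Ideal.span (Set.range F)).IsPrime := DiagonalBPCIPrime.isPrime_span_pair k h3 h4 F hF0 hF1
  have hX0 : (X 0 : MvPolynomial (Fin 6) k) ∉ Ideal.span (Set.range F) := fun h =>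
    DiagonalCIPair.mk_X_ne_zero_pair ![2, 3, 3, 4, 5, 5] (fun i => (DiagonalBPCIRow.two_le_a_le i).1) _ _ F
      (by rw [hF0, DiagonalBPCIRow.F0_eq_sum]) (by rw [hF1, DiagonalBPCIRow.F1_eq_sum]) 0 (Ideal.Quotient.eq_zero_iff_mem.mpr h)
  exact PointFloorLegalCI.pointFloor_input_legal k (Ideal.span (Set.range F)) 0 hX0 (fun j : Fin 6 => j = 2 ∨ j = 3 ∨ j = 4 ∨ j = 5)
    (reesT_mem_radical k F hF0 hF1) (fun j hj q _ => by
      rcases hj with rfl | rfl | rfl | rfl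
      · exact DiagonalBPCIChartsCM.cmCl_reesChart_two k F hF0 hF1 h3 q
      · exact DiagonalBPCIChartsCM.cmCl_reesChart_three k F hF0 hF1 h3 q
      · exact DiagonalBPCIChartsCM.cmCl_reesChart_four k F hF0 hF1 h4 q
      · exact DiagonalBPCIChartsCM.cmCl_reesChart_five k F hF0 hF1 h3 q)
    v hvm (vertex_not_mem_regularLocus k F hF0 hF1 p v hvm) (regular_of_specializes k F hF0 hF1 p hp v hvm) S' g' hg'

end Summit.ResolutionOfSingularities.ResolutionOfSingularities.Theorems.FInjectiveMacaulayfication.DiagonalBPCIPointFloorLegal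

end
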